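import Summits.HodgeConjecture.CorCM.MultiFieldWeilFrameTransfer
import Mathlib.RingTheory.TensorProduct.Maps
import HarnessLib

/-!
# MULTI-FIELD WEIL ENGINE — JOINT TRANSITIVITY OF `Aut(ℂ)` ON TUPLES OF EMBEDDINGS: two sufficient conditions — a common countable field through which every tuple of
# `τ`-embeddings factors, and (two fields) the tensor product `K₀ ⊗_k K₁` being a FIELD (linear disjointness)

Cell `pub-hodgecm2` (COR-CM), seat b30 gen 30 (2026-08-24); count-neutral own lane MULTI-FIELD WEIL ENGINE (stem `MultiFieldWeil*`).  Companion of the joint-transitivity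
hypotheses `hJ` of `CorCM/MultiFieldWeilJointPrimesHodge.lean` (`hodgeConjectureFor_biproduct_comp_of_sextics`, `…_of_jointPrimeTower_oneMember`) and of the ordered
hypotheses `hH` of `CorCM/MultiFieldWeilEqualPrimes.lean`.  Theorems only; no definition, no named fact, no `sorry`.  Nothing Hodge-theoretic is asserted here; `HC_CM` is
NOT proved.

* §1 **`exists_ringEquiv_comp_eq_family_of_factor`** — if every admissible family `(s_m)_m` of embeddings `K_m → ℂ` factors through ONE countable field `F`
  (`s_m = S ∘ J_m`), then `Aut(ℂ)` carries any admissible family to any other: extend `S ↦ S'` by `ZarhinLie.exists_ringEquiv_complex_comp_eq`.  This is the shape of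
  the `hJ` hypotheses, for any number of fields (take `F = K_0 ⊗_k ⋯ ⊗_k K_{r−1}` when it is a field, or any common over-field in which the `K_m` are linearly disjoint).
* §2 **`exists_ringEquiv_comp_eq_pair_of_isField_tensorProduct`** — TWO fields: if `K₀ ⊗_k K₁` is a field, every pair `(s₀, s₁)` of embeddings over `τ` is carried to
  every other pair by one automorphism of `ℂ` (the pair factors through `K₀ ⊗_k K₁ → ℂ`, `a ⊗ b ↦ s₀(a) s₁(b)`).  For two cubic extensions of `k` (sextic CM fields ∋ k)
  `K₀ ⊗_k K₁` is a field exactly when `K₀ ≇ K₁`.  **`jointTransitive_two_of_isField`** restates it in the `Fin 2`-family shape of the headlines.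
[cite: Shimura1998, §18.2 Lemma (i)] [cite: DixonMortimer1996, §1.6]

## References
* [Shimura1998] G. Shimura, *Abelian varieties with CM and modular functions*, §18.2 Lemma (i) (extension of embeddings to automorphisms of `ℂ`).
  [DixonMortimer1996] J. D. Dixon, B. Mortimer, *Permutation Groups*, GTM 163, §1.6.
-/

noncomputable section

open NumberField
open scoped TensorProduct

namespace Summit.HodgeConjecture.CorCM.MultiFieldWeil

open Literature.AlgebraicGeometry Literature.AlgebraicGeometry.Motives

/-! ## §1 Families factoring through one countable field -/

/-- **Families of embeddings that factor through ONE countable field are permuted transitively by `Aut(ℂ)`.**  If every family `s` with `P s` factors as `s_m = S ∘ J_m`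
through a countable field `F`, then for `P s`, `P s'` some automorphism `ρ` of `ℂ` has `ρ ∘ s_m = s'_m` for all `m`. [cite: Shimura1998, §18.2 Lemma (i)] -/
theorem exists_ringEquiv_comp_eq_family_of_factor {M : Type} {K : M → Type} [∀ m, Field (K m)] {F : Type} [Field F] [Countable F]
    (J : ∀ m, K m →+* F) (P : (∀ m, K m →+* ℂ) → Prop) (hfac : ∀ s, P s → ∃ S : F →+* ℂ, ∀ m, S.comp (J m) = s m)
    {s s' : ∀ m, K m →+* ℂ} (hs : P s) (hs' : P s') :
    ∃ ρ : ℂ ≃+* ℂ, ∀ m, (ρ : ℂ →+* ℂ).comp (s m) = s' m := by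
  obtain ⟨S, hS⟩ := hfac s hs
  obtain ⟨S', hS'⟩ := hfac s' hs'
  obtain ⟨ρ, hρ⟩ := ZarhinLie.exists_ringEquiv_complex_comp_eq S S'
  refine ⟨ρ, fun m => ?_⟩
  rw [← hS m, ← hS' m, ← RingHom.comp_assoc]
  congr 1
  exact RingHom.ext fun a => hρ a

/-! ## §2 Two fields whose tensor product over `k` is a field -/

section Pair

variable {k K₀ K₁ : Type} [Field k] [NumberField k] [Field K₀] [NumberField K₀] [Field K₁] [NumberField K₁] [Algebra k K₀] [Algebra k K₁]

/-- **TWO FIELDS WITH `K₀ ⊗_k K₁` A FIELD: `Aut(ℂ)` is transitive on the pairs of embeddings over `τ`.**  The pair `(s₀, s₁)` factors through the `k`-algebra map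
`K₀ ⊗_k K₁ → ℂ`, `a ⊗ b ↦ s₀(a) s₁(b)`; `K₀ ⊗_k K₁` is a countable field, so §1 applies. [cite: Shimura1998, §18.2 Lemma (i)] [cite: DixonMortimer1996, §1.6] -/
theorem exists_ringEquiv_comp_eq_pair_of_isField_tensorProduct (hF : IsField (K₀ ⊗[k] K₁)) {τ : k →+* ℂ}
    {s₀ s₀' : K₀ →+* ℂ} {s₁ s₁' : K₁ →+* ℂ} (h₀ : s₀.comp (algebraMap k K₀) = τ) (h₀' : s₀'.comp (algebraMap k K₀) = τ)
    (h₁ : s₁.comp (algebraMap k K₁) = τ) (h₁' : s₁'.comp (algebraMap k K₁) = τ) :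
    ∃ ρ : ℂ ≃+* ℂ, (ρ : ℂ →+* ℂ).comp s₀ = s₀' ∧ (ρ : ℂ →+* ℂ).comp s₁ = s₁' := by
  letI : Algebra k ℂ := τ.toAlgebra
  -- `K₀ ⊗_k K₁` is a countable field
  haveI : Countable k := Countable.of_equiv _ (Module.finBasis ℚ k).equivFun.toEquiv.symm
  haveI : IsScalarTower ℚ k K₀ := IsScalarTower.of_algebraMap_eq fun q => by
    rw [eq_ratCast, eq_ratCast, map_ratCast]
  haveI : IsScalarTower ℚ k K₁ := IsScalarTower.of_algebraMap_eq fun q => by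
    rw [eq_ratCast, eq_ratCast, map_ratCast]
  haveI : Module.Finite k K₀ := Module.Finite.of_restrictScalars_finite ℚ k K₀
  haveI : Module.Finite k K₁ := Module.Finite.of_restrictScalars_finite ℚ k K₁
  haveI : Countable (K₀ ⊗[k] K₁) := Countable.of_equiv _ (Module.finBasis k (K₀ ⊗[k] K₁)).equivFun.toEquiv.symm
  letI : Field (K₀ ⊗[k] K₁) := hF.toField
  -- a pair over `τ` factors through the tensor product
  have key : ∀ (t₀ : K₀ →+* ℂ) (t₁ : K₁ →+* ℂ), t₀.comp (algebraMap k K₀) = τ → t₁.comp (algebraMap k K₁) = τ →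
      ∃ S : K₀ ⊗[k] K₁ →+* ℂ, S.comp (Algebra.TensorProduct.includeLeft (S := k) : K₀ →ₐ[k] K₀ ⊗[k] K₁).toRingHom = t₀ ∧
        S.comp (Algebra.TensorProduct.includeRight : K₁ →ₐ[k] K₀ ⊗[k] K₁).toRingHom = t₁ := by
    intro t₀ t₁ ht₀ ht₁
    have hc₀ : ∀ c : k, t₀ (algebraMap k K₀ c) = algebraMap k ℂ c := fun c => by
      change t₀ (algebraMap k K₀ c) = τ c
      rw [← ht₀]
      rfl
    have hc₁ : ∀ c : k, t₁ (algebraMap k K₁ c) = algebraMap k ℂ c := fun c => by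
      change t₁ (algebraMap k K₁ c) = τ c
      rw [← ht₁]
      rfl
    let f₀ : K₀ →ₐ[k] ℂ :=
      { t₀ with
        commutes' := hc₀ }
    let f₁ : K₁ →ₐ[k] ℂ :=
      { t₁ with
        commutes' := hc₁ }
    have hfg : ∀ x y, Commute (f₀ x) (f₁ y) := fun x y => Commute.all _ _
    refine ⟨(Algebra.TensorProduct.lift f₀ f₁ hfg).toRingHom, ?_, ?_⟩
    · ext a
      show Algebra.TensorProduct.lift f₀ f₁ hfg (a ⊗ₜ 1) = t₀ a
      rw [Algebra.TensorProduct.lift_tmul, map_one, mul_one]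
      rfl
    · ext b
      show Algebra.TensorProduct.lift f₀ f₁ hfg (1 ⊗ₜ b) = t₁ b
      rw [Algebra.TensorProduct.lift_tmul, map_one, one_mul]
      rfl
  obtain ⟨S, hS₀, hS₁⟩ := key s₀ s₁ h₀ h₁
  obtain ⟨S', hS₀', hS₁'⟩ := key s₀' s₁' h₀' h₁'
  obtain ⟨ρ, hρ⟩ := ZarhinLie.exists_ringEquiv_complex_comp_eq S S'
  have hρS : (ρ : ℂ →+* ℂ).comp S = S' := RingHom.ext fun a => hρ a
  refine ⟨ρ, ?_, ?_⟩
  · rw [← hS₀, ← hS₀', ← RingHom.comp_assoc, hρS]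
  · rw [← hS₁, ← hS₁', ← RingHom.comp_assoc, hρS]

end Pair

/-! ### The `Fin 2`-family shape of the headlines -/

section Two

variable {I : Type} {Kf : I → Type} [∀ i, Field (Kf i)] [∀ i, NumberField (Kf i)] {i₀ : I} {is : Fin 2 → I} {τ : Kf i₀ →+* ℂ}

/-- **Two fields with `K₀ ⊗_k K₁` a field: the joint-transitivity hypothesis `hJ` of `hodgeConjectureFor_biproduct_comp_of_sextics` / `…_of_decics` (`r = 2`)** —
`Aut(ℂ)` carries every family `(s_0, s_1)` of `τ`-embeddings to every other. [cite: Shimura1998, §18.2 Lemma (i)] -/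
theorem jointTransitive_two_of_isField (im : ∀ m : Fin 2, Kf i₀ →+* Kf (is m))
    (hF : letI : Algebra (Kf i₀) (Kf (is 0)) := (im 0).toAlgebra
      letI : Algebra (Kf i₀) (Kf (is 1)) := (im 1).toAlgebra
      IsField (Kf (is 0) ⊗[Kf i₀] Kf (is 1)))
    (s s' : ∀ m : Fin 2, Kf (is m) →+* ℂ) (hss' : ∀ m, (s m).comp (im m) = τ ∧ (s' m).comp (im m) = τ) :
    ∃ ρ : ℂ ≃+* ℂ, ∀ m, (ρ : ℂ →+* ℂ).comp (s m) = s' m := by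
  letI : Algebra (Kf i₀) (Kf (is 0)) := (im 0).toAlgebra
  letI : Algebra (Kf i₀) (Kf (is 1)) := (im 1).toAlgebra
  obtain ⟨ρ, hρ₀, hρ₁⟩ := exists_ringEquiv_comp_eq_pair_of_isField_tensorProduct hF (τ := τ) (s₀ := s 0) (s₀' := s' 0) (s₁ := s 1) (s₁' := s' 1)
    (hss' 0).1 (hss' 0).2 (hss' 1).1 (hss' 1).2
  refine ⟨ρ, fun m => ?_⟩
  fin_cases m
  · exact hρ₀
  · exact hρ₁

end Two

end Summit.HodgeConjecture.CorCM.MultiFieldWeil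

end
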